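import Summits.BirchSwinnertonDyer.BirchSwinnertonDyer.Theorems.GenusKolyvaginAtTwoPowDvdShaCardAtTwoRTBottomRungOnHabitat
import HarnessLib

/-!
# Route `GenusKolyvaginAtTwo`, crux L_T `PowDvdShaCardAtTwoRT` (stmt-BirchSwinnertonDyer-23242), LINE 18 stub KS —
# THE SOCKET `hbot` OF THE KS ASSEMBLY IN THE MARGIN-`k` CLASS: the bottom rung with `FrobEqFrobInfty W K (2^(L+k))` KEPT for the output primes

Seat `bsd-line-gk2-p5` g24 (cell `bsd-f1-sign2`, SUPPLY lineage), `--supports stmt-BirchSwinnertonDyer-23242` (helper; closes nothing).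
THEOREMS ONLY (no definition, no named fact, no `sorry`).  BSD is NOT proved by any of this; neither is the crux nor any stub.

WHY.  gk2-p2 g19's KS assembly `PlusDescent.kolyvaginSuppliesAtTwo_of_deepSwap` (p727242) proves the registered conclusion of stub KS modulo
three sockets `hbot`, `hswap`, `hK` over a prime class `(Zhang–Kolyvagin q ∧ L ≤ index q) ∧ G q`, where the assembler's `G` is implied by the
margin-`k` predicate `L + k ≤ index q ∧ FrobEqFrobInfty W K (2^(L+k)) q`.  The eigen index law `hK` NEEDS Gross's Frobenius condition at every
prime of the class (`…RTEigenIndexSocket`, this seat), so `G` cannot be `⊤`; but LEAD gk2-p1 g17's bottom-rung outputs in the socket currencies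
(`exists_deep_primitive_of_gross_witness_pow`, `exists_deep_notTwoDvd_of_gross_witness`, `…_onHabitat`) certify the output primes only as
`Zhang–Kolyvagin ∧ L ≤ index` — the `FrobEqFrobInfty W K (2^L)` that the all-deep closure DOES prove (`exists_deep_primitive_of_gross_witness'`)
is dropped.  This file keeps it: run the closure at level `L + k` (class `index ≥ L+k ∧ FrobEqFrobInfty (2^(L+k))`) and read the order at level `L`
(`addOrderOf_kolyvaginClass_two_pow_eq_of_four`), so that `hbot` holds VERBATIM for every `G` implied by the margin-`k` predicate.
* `exists_deep_primitive_of_gross_witness_pow_frobEq` — `exists_deep_primitive_of_gross_witness_pow` with `FrobEqFrobInfty W K (2^L) q` kept.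
* **`hbot_socket_margin`** — the `hbot` binder of `kolyvaginSuppliesAtTwo_of_deepSwap` for any `G` with
  `hG : ZK q → L + k ≤ index q → FrobEqFrobInfty W K (2^(L+k)) q → G q`, from a level-4 Gross witness (`addOrderOf c₂(e₀) = 4`), modulo
  (NPh_{L+k}^{2N}) and the (V44)-socket `hTr` at level `L + k` (LEAD's `…RTBottomRungTransverse` discharges `hTr`).
* `hbot_socket_margin_onHabitat` — the same on the cut habitat («∃ odd multiplicative place», (D-NPh)), divisibility witness
  `P(n₀) ∉ 2E(K[n₀])`, level-2 Gross primes of index `≥ 2`; (NPh) discharged by gk2-p3's `nonPhantomAtTwo_of_hasMultiplicativeReductionAt`.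
HONEST FRAMING: bookkeeping over LEAD's chain; closes nothing.

References: [McCallumLMS1991] §5 Prop. 5.2 and its proof (p. 285); [Kolyvagin1991MathAnn] Thm. 2.2; [GrossLMS1991] §3 (3.1)–(3.3).
-/

set_option autoImplicit false
-- the Theorems namespace of this sub repeats the summit name by design (D-0017 nested layout)
set_option linter.dupNamespace false

noncomputable section

open scoped Classical

open Field NumberField IsDedekindDomain Function WeierstrassCurve
open Literature.NumberTheory.EllipticCurves
open Literature.NumberTheory.GaloisRepresentations
open Literature.NumberTheory.GaloisCohomology
open Summit.BirchSwinnertonDyer.BirchSwinnertonDyer.Theses.GenusKolyvaginAtTwo (KolyvaginRelationAtTwo)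

namespace Summit.BirchSwinnertonDyer.BirchSwinnertonDyer.Theorems.GenusExact.RelaxedCount

variable (W : WeierstrassCurve ℚ) [W.IsElliptic] [W.IsGloballyMinimal] [NeZero (W.conductorNorm ℤ)]
  {K : Type} [Field K] [NumberField K]

/-- **THE BOTTOM RUNG in the minima-socket currency WITH the deep Frobenius condition kept**: as LEAD's
`exists_deep_primitive_of_gross_witness_pow` (either witness parity), the output primes certified `Zhang–Kolyvagin ∧ L ≤ index ∧
FrobEqFrobInfty W K (2^L)` (the closure `exists_deep_primitive_of_gross_witness'` proves all three; `_pow` forgot the third).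
[cite: McCallumLMS1991, §5 proof of Prop. 5.2, p. 285] [cite: Kolyvagin1991MathAnn, Thm. 2.2] -/
theorem exists_deep_primitive_of_gross_witness_pow_frobEq (hQ2 : KolyvaginRelationAtTwo) (hcm : ¬ W.HasCM) (hΔ : W.Δ < 0)
    (hT : Odd W.tamagawaProduct) (hρ : ∀ m : ℕ, W.HasSurjectiveModNGaloisRep (2 ^ m : ℕ))
    (hK : IsImaginaryQuadratic K) (hodd : Odd (NumberField.discr K)) (h3 : NumberField.discr K ≠ -3)
    (hHe : SatisfiesHeegnerHypothesis (W.conductorNorm ℤ) K) (hns : ¬ IsSquare ((NumberField.discr K : ℚ) * -|W.Δ|))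
    (Dt : ModularForms.ModularParametrizationData W (W.conductorNorm ℤ)) (β : ℤ) (ι : K →+* ℂ) {L : ℕ} (hL2 : 2 ≤ L)
    (hNPh : ∀ z : galH1Torsion (W.baseChange K) ((2 ^ L : ℕ) : ℤ),
      (∀ ρ' ∈ torsionFixing (W.baseChange K) ((2 ^ L : ℕ) : ℤ), h1Eval (W.baseChange K) ((2 ^ L : ℕ) : ℤ) z ρ' = 0) →
      (∀ w : HeightOneSpectrum (𝓞 K), ((2 * W.conductorNorm ℤ : ℕ) : 𝓞 K) ∈ w.asIdeal →
        z ∈ selmerLocalKer (W.baseChange K) (w.adicCompletion K) ((2 ^ L : ℕ) : ℤ)) → z = 0)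
    (hTr : ∀ (n' : ℕ) (d' : KolyvaginHeegnerData Dt β ι n') (Z : galoisCohomology (W.torsionGaloisModule ((2 ^ 2 : ℕ) : ℤ)) 1),
      Squarefree n' →
      (∀ q ∈ n'.primeFactors, Zhang2014.IsKolyvaginPrime (W.conductorNorm ℤ) W K 2 q ∧ 2 ≤ Zhang2014.kolyvaginIndex W 2 q ∧
        FrobEqFrobInfty W K (2 ^ 2) q) →
      resTorsion W K ((2 ^ 2 : ℕ) : ℤ) Z = d'.kolyvaginClass Nat.prime_two 2 →
      ∀ (v : HeightOneSpectrum (𝓞 ℚ)) (ℓ : ℕ), ℓ ∈ n'.primeFactors → (ℓ : 𝓞 ℚ) ∈ v.asIdeal →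
        L ≤ Zhang2014.kolyvaginIndex W 2 ℓ → FrobEqFrobInfty W K (2 ^ L) ℓ →
        ∀ 𝔓 ∈ v.primesAbove, ∀ F c₀ : absoluteGaloisGroup ℚ, IsArithFrobAt (𝓞 ℚ) F 𝔓 →
          IsComplexConjugation (Rat.castHom ℝ) c₀ → (∀ P : geomTorsion W ((2 ^ 2 : ℕ) : ℤ), F • P = c₀ • P) →
          ∃ P₁ : geomTorsion W ((2 ^ 2 : ℕ) : ℤ), h1Eval W _ ((2 : ℕ) • Z) F = F • P₁ - P₁)
    {n₀ : ℕ} (hn₀ : Squarefree n₀)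
    (hn₀K : ∀ q ∈ n₀.primeFactors, Zhang2014.IsKolyvaginPrime (W.conductorNorm ℤ) W K 2 q ∧ 2 ≤ Zhang2014.kolyvaginIndex W 2 q ∧
      FrobEqFrobInfty W K (2 ^ 2) q)
    (e₀ : KolyvaginHeegnerData Dt β ι n₀) (he₀ : addOrderOf (e₀.kolyvaginClass Nat.prime_two 2) = 2 ^ 2) :
    ∃ (n : ℕ) (e : KolyvaginHeegnerData Dt β ι n), Squarefree n ∧
      (n.primeFactors.card = n₀.primeFactors.card ∨ n.primeFactors.card = n₀.primeFactors.card + 1) ∧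
      (∀ q ∈ n.primeFactors, Zhang2014.IsKolyvaginPrime (W.conductorNorm ℤ) W K 2 q ∧ L ≤ Zhang2014.kolyvaginIndex W 2 q ∧
        FrobEqFrobInfty W K (2 ^ L) q) ∧
      addOrderOf (e.kolyvaginClass Nat.prime_two L) = 2 ^ L := by
  have hρ2 : W.HasSurjectiveModNGaloisRep 2 := by simpa using hρ 1
  obtain ⟨n, e, hn, hcard, hK', he⟩ := exists_deep_primitive_of_gross_witness' W hQ2 hcm hΔ hT hρ hK hodd h3 hHe hns Dt β ι hL2 hNPh hTr hn₀
    hn₀K e₀ he₀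
  have hK'' : ∀ q ∈ n.primeFactors, Zhang2014.IsKolyvaginPrime (W.conductorNorm ℤ) W K 2 q ∧ L ≤ Zhang2014.kolyvaginIndex W 2 q :=
    fun q hq ↦ ⟨(hK' q hq).1, (hK' q hq).2.1⟩
  exact ⟨n, e, hn, hcard, hK', addOrderOf_kolyvaginClass_two_pow_eq_of_four W hK hodd h3 hHe hρ2 Dt β ι hL2 hn hK'' e he⟩

/-- **THE SOCKET `hbot` OF THE KS ASSEMBLY, margin-`k` class.**  On L's frame with Q2, for every prime predicate `G` implied by
`Zhang–Kolyvagin q ∧ L + k ≤ index q ∧ FrobEqFrobInfty W K (2^(L+k)) q` (the binder `hG` of `PlusDescent.kolyvaginSuppliesAtTwo_of_deepSwap`),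
from a level-4 Gross witness (`n₀` square-free of Zhang–Kolyvagin primes of index `≥ 2` with `FrobEqFrobInfty W K 4`, a datum with
`addOrderOf c₂(e₀) = 4`), modulo (NPh^{2N}) and the (V44)-socket `hTr` at level `L + k`:  VERBATIM
`∃ n d, Squarefree n ∧ (∀ q ∈ n.primeFactors, (ZK q ∧ L ≤ index q) ∧ G q) ∧ addOrderOf c_L(d) = 2^L`.
[cite: McCallumLMS1991, §5 proof of Prop. 5.2, p. 285] [cite: Kolyvagin1991MathAnn, Thm. 2.2] -/
theorem hbot_socket_margin (hQ2 : KolyvaginRelationAtTwo) (hcm : ¬ W.HasCM) (hΔ : W.Δ < 0)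
    (hT : Odd W.tamagawaProduct) (hρ : ∀ m : ℕ, W.HasSurjectiveModNGaloisRep (2 ^ m : ℕ))
    (hK : IsImaginaryQuadratic K) (hodd : Odd (NumberField.discr K)) (h3 : NumberField.discr K ≠ -3)
    (hHe : SatisfiesHeegnerHypothesis (W.conductorNorm ℤ) K) (hns : ¬ IsSquare ((NumberField.discr K : ℚ) * -|W.Δ|))
    (Dt : ModularForms.ModularParametrizationData W (W.conductorNorm ℤ)) (β : ℤ) (ι : K →+* ℂ) {L : ℕ} (hL2 : 2 ≤ L) (k : ℕ)
    (hNPh : ∀ z : galH1Torsion (W.baseChange K) ((2 ^ (L + k) : ℕ) : ℤ),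
      (∀ ρ' ∈ torsionFixing (W.baseChange K) ((2 ^ (L + k) : ℕ) : ℤ), h1Eval (W.baseChange K) ((2 ^ (L + k) : ℕ) : ℤ) z ρ' = 0) →
      (∀ w : HeightOneSpectrum (𝓞 K), ((2 * W.conductorNorm ℤ : ℕ) : 𝓞 K) ∈ w.asIdeal →
        z ∈ selmerLocalKer (W.baseChange K) (w.adicCompletion K) ((2 ^ (L + k) : ℕ) : ℤ)) → z = 0)
    (hTr : ∀ (n' : ℕ) (d' : KolyvaginHeegnerData Dt β ι n') (Z : galoisCohomology (W.torsionGaloisModule ((2 ^ 2 : ℕ) : ℤ)) 1),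
      Squarefree n' →
      (∀ q ∈ n'.primeFactors, Zhang2014.IsKolyvaginPrime (W.conductorNorm ℤ) W K 2 q ∧ 2 ≤ Zhang2014.kolyvaginIndex W 2 q ∧
        FrobEqFrobInfty W K (2 ^ 2) q) →
      resTorsion W K ((2 ^ 2 : ℕ) : ℤ) Z = d'.kolyvaginClass Nat.prime_two 2 →
      ∀ (v : HeightOneSpectrum (𝓞 ℚ)) (ℓ : ℕ), ℓ ∈ n'.primeFactors → (ℓ : 𝓞 ℚ) ∈ v.asIdeal →
        L + k ≤ Zhang2014.kolyvaginIndex W 2 ℓ → FrobEqFrobInfty W K (2 ^ (L + k)) ℓ →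
        ∀ 𝔓 ∈ v.primesAbove, ∀ F c₀ : absoluteGaloisGroup ℚ, IsArithFrobAt (𝓞 ℚ) F 𝔓 →
          IsComplexConjugation (Rat.castHom ℝ) c₀ → (∀ P : geomTorsion W ((2 ^ 2 : ℕ) : ℤ), F • P = c₀ • P) →
          ∃ P₁ : geomTorsion W ((2 ^ 2 : ℕ) : ℤ), h1Eval W _ ((2 : ℕ) • Z) F = F • P₁ - P₁)
    (G : ℕ → Prop)
    (hG : ∀ q : ℕ, Zhang2014.IsKolyvaginPrime (W.conductorNorm ℤ) W K 2 q → L + k ≤ Zhang2014.kolyvaginIndex W 2 q →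
      FrobEqFrobInfty W K (2 ^ (L + k)) q → G q)
    {n₀ : ℕ} (hn₀ : Squarefree n₀)
    (hn₀K : ∀ q ∈ n₀.primeFactors, Zhang2014.IsKolyvaginPrime (W.conductorNorm ℤ) W K 2 q ∧ 2 ≤ Zhang2014.kolyvaginIndex W 2 q ∧
      FrobEqFrobInfty W K (2 ^ 2) q)
    (e₀ : KolyvaginHeegnerData Dt β ι n₀) (he₀ : addOrderOf (e₀.kolyvaginClass Nat.prime_two 2) = 2 ^ 2) :
    ∃ (n : ℕ) (d : KolyvaginHeegnerData Dt β ι n), Squarefree n ∧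
      (∀ q ∈ n.primeFactors, (Zhang2014.IsKolyvaginPrime (W.conductorNorm ℤ) W K 2 q ∧ L ≤ Zhang2014.kolyvaginIndex W 2 q) ∧ G q) ∧
      addOrderOf (d.kolyvaginClass Nat.prime_two L) = 2 ^ L := by
  have hρ2 : W.HasSurjectiveModNGaloisRep 2 := by simpa using hρ 1
  have hL2' : 2 ≤ L + k := by omega
  obtain ⟨n, e, hn, -, hK', he⟩ := exists_deep_primitive_of_gross_witness' W hQ2 hcm hΔ hT hρ hK hodd h3 hHe hns Dt β ι hL2' hNPh hTr hn₀
    hn₀K e₀ he₀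
  have hK'' : ∀ q ∈ n.primeFactors, Zhang2014.IsKolyvaginPrime (W.conductorNorm ℤ) W K 2 q ∧ L ≤ Zhang2014.kolyvaginIndex W 2 q :=
    fun q hq ↦ ⟨(hK' q hq).1, le_trans (Nat.le_add_right L k) (hK' q hq).2.1⟩
  exact ⟨n, e, hn, fun q hq ↦ ⟨hK'' q hq, hG q (hK' q hq).1 (hK' q hq).2.1 (hK' q hq).2.2⟩,
    addOrderOf_kolyvaginClass_two_pow_eq_of_four W hK hodd h3 hHe hρ2 Dt β ι hL2 hn hK'' e he⟩

/-- **THE SOCKET `hbot`, margin-`k` class, ON THE CUT HABITAT** («∃ odd place `v ∣ N` of multiplicative reduction», director (D-NPh)): as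
`hbot_socket_margin`, with (NPh) DISCHARGED by gk2-p3's `nonPhantomAtTwo_of_hasMultiplicativeReductionAt`, the witness in Kolyvagin's divisibility
currency `P(n₀) ∉ 2E(K[n₀])`, and LEVEL-2 Gross primes of index `≥ 2` (the level-4 condition follows on `Δ < 0` with the 2-adic tower onto,
gk2-p5 g22).  Displayed residuals: the (V44)-socket `hTr` at level `L + k` and Q2.
[cite: McCallumLMS1991, §5 Prop. 5.2 and its proof, p. 285] [cite: GrossLMS1991, §3 (3.3)] -/
theorem hbot_socket_margin_onHabitat (hQ2 : KolyvaginRelationAtTwo) (hcm : ¬ W.HasCM) (hΔ : W.Δ < 0)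
    (hT : Odd W.tamagawaProduct) (hρ : ∀ m : ℕ, W.HasSurjectiveModNGaloisRep (2 ^ m : ℕ))
    (hK : IsImaginaryQuadratic K) (hodd : Odd (NumberField.discr K)) (h3 : NumberField.discr K ≠ -3)
    (hHe : SatisfiesHeegnerHypothesis (W.conductorNorm ℤ) K) (hns : ¬ IsSquare ((NumberField.discr K : ℚ) * -|W.Δ|))
    (hns₂ : ¬ IsSquare ((NumberField.discr K : ℚ) * (-(2 * |W.Δ|))))
    {v : HeightOneSpectrum (𝓞 ℚ)} (h2v : ((2 : ℕ) : 𝓞 ℚ) ∉ v.asIdeal) (hNv : ((W.conductorNorm ℤ : ℕ) : 𝓞 ℚ) ∈ v.asIdeal)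
    (hmult : W.HasMultiplicativeReductionAt v)
    (Dt : ModularForms.ModularParametrizationData W (W.conductorNorm ℤ)) (β : ℤ) (ι : K →+* ℂ) {L : ℕ} (hL2 : 2 ≤ L) (k : ℕ)
    (hTr : ∀ (n' : ℕ) (d' : KolyvaginHeegnerData Dt β ι n') (Z : galoisCohomology (W.torsionGaloisModule ((2 ^ 2 : ℕ) : ℤ)) 1),
      Squarefree n' →
      (∀ q ∈ n'.primeFactors, Zhang2014.IsKolyvaginPrime (W.conductorNorm ℤ) W K 2 q ∧ 2 ≤ Zhang2014.kolyvaginIndex W 2 q ∧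
        FrobEqFrobInfty W K (2 ^ 2) q) →
      resTorsion W K ((2 ^ 2 : ℕ) : ℤ) Z = d'.kolyvaginClass Nat.prime_two 2 →
      ∀ (v : HeightOneSpectrum (𝓞 ℚ)) (ℓ : ℕ), ℓ ∈ n'.primeFactors → (ℓ : 𝓞 ℚ) ∈ v.asIdeal →
        L + k ≤ Zhang2014.kolyvaginIndex W 2 ℓ → FrobEqFrobInfty W K (2 ^ (L + k)) ℓ →
        ∀ 𝔓 ∈ v.primesAbove, ∀ F c₀ : absoluteGaloisGroup ℚ, IsArithFrobAt (𝓞 ℚ) F 𝔓 →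
          IsComplexConjugation (Rat.castHom ℝ) c₀ → (∀ P : geomTorsion W ((2 ^ 2 : ℕ) : ℤ), F • P = c₀ • P) →
          ∃ P₁ : geomTorsion W ((2 ^ 2 : ℕ) : ℤ), h1Eval W _ ((2 : ℕ) • Z) F = F • P₁ - P₁)
    (G : ℕ → Prop)
    (hG : ∀ q : ℕ, Zhang2014.IsKolyvaginPrime (W.conductorNorm ℤ) W K 2 q → L + k ≤ Zhang2014.kolyvaginIndex W 2 q →
      FrobEqFrobInfty W K (2 ^ (L + k)) q → G q)
    {n₀ : ℕ} (hn₀ : Squarefree n₀)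
    (hn₀K : ∀ q ∈ n₀.primeFactors, Zhang2014.IsKolyvaginPrime (W.conductorNorm ℤ) W K 2 q ∧ 2 ≤ Zhang2014.kolyvaginIndex W 2 q ∧
      FrobEqFrobInfty W K 2 q)
    (e₀ : KolyvaginHeegnerData Dt β ι n₀)
    (he₀ : ¬ ∃ Q : (W.baseChange (ringClassField K ι n₀)).toAffine.Point, (2 : ℤ) • Q = e₀.derivedPoint) :
    ∃ (n : ℕ) (d : KolyvaginHeegnerData Dt β ι n), Squarefree n ∧
      (∀ q ∈ n.primeFactors, (Zhang2014.IsKolyvaginPrime (W.conductorNorm ℤ) W K 2 q ∧ L ≤ Zhang2014.kolyvaginIndex W 2 q) ∧ G q) ∧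
      addOrderOf (d.kolyvaginClass Nat.prime_two L) = 2 ^ L := by
  have hρ' : ∀ n : ℕ, 0 < n → W.HasSurjectiveModNGaloisRep ((2 : ℤ) ^ n) := fun n _ ↦ by exact_mod_cast hρ n
  have hρ2 : W.HasSurjectiveModNGaloisRep 2 := by simpa using hρ 1
  have hNPh := NonPhantomPow.nonPhantomAtTwo_of_hasMultiplicativeReductionAt W hT hρ' hK hodd hns hns₂
    (NeZero.ne (W.conductorNorm ℤ)) hHe h2v hNv hmult (L + k) (by omega)
  have hn₀K' : ∀ q ∈ n₀.primeFactors, Zhang2014.IsKolyvaginPrime (W.conductorNorm ℤ) W K 2 q ∧ 2 ≤ Zhang2014.kolyvaginIndex W 2 q ∧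
      FrobEqFrobInfty W K (2 ^ 2) q := fun q hq ↦
    ⟨(hn₀K q hq).1, (hn₀K q hq).2.1, GrossLevelAtTwo.frobEqFrobInfty_two_pow_of_frobEqFrobInfty_two W K hK hΔ (M := 2) (by norm_num)
      (hρ 2) (hn₀K q hq).1 (hn₀K q hq).2.1 (hn₀K q hq).2.2⟩
  have he₀' : addOrderOf (e₀.kolyvaginClass Nat.prime_two 2) = 2 ^ 2 :=
    addOrderOf_kolyvaginClass_two_eq_pow_of_not_two_dvd_single W hK hodd h3 hHe hρ2 Dt β ι (M := 2) (by norm_num) hn₀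
      (fun q hq ↦ ⟨(hn₀K' q hq).1, (hn₀K' q hq).2.1⟩) e₀ he₀
  exact hbot_socket_margin W hQ2 hcm hΔ hT hρ hK hodd h3 hHe hns Dt β ι hL2 k hNPh hTr G hG hn₀ hn₀K' e₀ he₀'

end Summit.BirchSwinnertonDyer.BirchSwinnertonDyer.Theorems.GenusExact.RelaxedCount

end
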